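import Mathlib
import Summits.PneNP.PneNP.Theorems.PstarGraphQuadGapInstance

/-!
# The `K_{3,3}` / Hamiltonian-nine-cycle gadget (ROUND-24 item T24.8f, part I: the local gadget)

FRONTIER range-avoidance ladder (cell `pnp-ideate`, ROUND-24 gap-lemma programme; restricted-model combinatorics — nothing here bears
on `P` versus `NP`).

The cell's unit test for «any proof of `PstarGapLemmaSO` must use expansion on the cyclic part of the XOR graph» (planner seat p3,
memo §13 R8): ONE copy of the gadget `𝔊` has six AND variables `p₀ p₁ p₂ q₀ q₁ q₂` (local indices `9…14`) and nine XOR variables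
`x₀ … x₈` (local indices `0…8`); output `t < 9` reads `(x_t, x_{t+1 mod 9}, p_{π t}, q_{κ t})` where `t ↦ (π t, κ t)` runs through the
nine edges of `K_{3,3}` in a Hamiltonian order in which consecutive edges are disjoint (`loc`).  Decide-checked here: injective slots,
typedness, simple overlaps (`#(vs t ∩ vs t') ≤ 1`), degree `≤ 3`; and the semantics: summing the nine outputs kills every `x` and leaves
`(p₀+p₁+p₂)(q₀+q₁+q₂)`, so with targets `y = e₀` (odd sum) every assignment satisfying all nine outputs has `p₀ ⊕ p₁ ⊕ p₂ = 1`
(`ploc_of_all`, via the 512-case `cycle_cancel` and the 64-case `k33_product`); conversely `zfull` (all AND variables `1`) satisfies all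
nine outputs with `P = 1`, and `zdel t₀` (all AND variables `0`) satisfies all outputs but `t₀` with `P = 0`.  Part II
(`PstarGapNeedsExpansion`) stacks `N` copies and one parity constraint.
-/

set_option linter.dupNamespace false -- `Summit.PneNP.PneNP.…`: summit = sub-problem name (D-0017 single-conjunct layout)

open Finset
open Summit.PneNP.PneNP.Theorems.PstarGraphQuadGapInstance (bpar bpar_union bpar_insert bpar_singleton bpar_congr bpar_map)

namespace Summit.PneNP.PneNP.Theorems.PstarGapGadget

/-! ## `xor`-sums: two more rules -/

/-- `bpar` of a pointwise `xor`. -/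
theorem bpar_xor {α : Type*} [DecidableEq α] (f g : α → Bool) :
    ∀ s : Finset α, bpar s (fun x => xor (f x) (g x)) = xor (bpar s f) (bpar s g) := by
  intro s
  induction s using Finset.induction_on with
  | empty => simp [bpar]
  | insert a s ha ih =>
    rw [bpar_insert ha, bpar_insert ha, bpar_insert ha, ih]
    cases f a <;> cases g a <;> cases bpar s f <;> cases bpar s g <;> rfl

/-- `bpar` over a product set, iterated. -/
theorem bpar_product {α β : Type*} [DecidableEq α] [DecidableEq β] (t : Finset β) (f : α × β → Bool) :
    ∀ s : Finset α, bpar (s ×ˢ t) f = bpar s (fun a => bpar t (fun b => f (a, b))) := by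
  intro s
  induction s using Finset.induction_on with
  | empty => simp [bpar]
  | insert a s ha ih =>
    have hdisj : Disjoint (({a} : Finset α) ×ˢ t) (s ×ˢ t) := by
      rw [disjoint_left]
      rintro ⟨x, y⟩ h1 h2
      rw [mem_product, mem_singleton] at h1
      rw [mem_product] at h2
      exact ha (h1.1 ▸ h2.1)
    rw [insert_eq, union_product, bpar_union hdisj, singleton_product, bpar_map, ih, ← insert_eq, bpar_insert ha]
    rfl

/-- `bpar` of a constant `true` is the parity of the cardinality. -/
theorem bpar_true {α : Type*} (s : Finset α) : bpar s (fun _ => true) = decide (Odd s.card) := by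
  unfold bpar
  rw [filter_true_of_mem fun _ _ => rfl]

/-! ## The local gadget -/

/-- `π`: the `p`-endpoint of the `t`-th edge of `K_{3,3}` in the Hamiltonian order. -/
def pI : Fin 9 → Fin 3 := ![0, 1, 2, 0, 1, 2, 0, 1, 2]

/-- `κ`: the `q`-endpoint of the `t`-th edge. -/
def qI : Fin 9 → Fin 3 := ![0, 1, 2, 1, 2, 0, 2, 0, 1]

/-- The XOR variable `x_u` (local index `u < 9`). -/
def xv (u : Fin 9) : Fin 15 := ⟨u.val, by omega⟩

/-- The AND variable `p_k` (local index `9 + k`). -/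
def pv (k : Fin 3) : Fin 15 := ⟨9 + k.val, by omega⟩

/-- The AND variable `q_k` (local index `12 + k`). -/
def qv (k : Fin 3) : Fin 15 := ⟨12 + k.val, by omega⟩

/-- The successor on the nine-cycle. -/
def nx (t : Fin 9) : Fin 9 := t + 1

/-- The slots of output `t`: `(x_t, x_{t+1}, p_{π t}, q_{κ t})`. -/
def loc (t : Fin 9) (s : Fin 4) : Fin 15 :=
  if s.val = 0 then xv t else if s.val = 1 then xv (nx t) else if s.val = 2 then pv (pI t) else qv (qI t)

/-- The variable set of output `t`. -/
def vs (t : Fin 9) : Finset (Fin 15) := univ.image (loc t)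

/-- Slots are injective. -/
theorem loc_injective : ∀ t : Fin 9, Function.Injective (loc t) := by decide

/-- XOR slots read local indices `< 9`. -/
theorem loc_lt : ∀ (t : Fin 9) (s : Fin 4), s.val < 2 → (loc t s).val < 9 := by decide

/-- AND slots read local indices `≥ 9`. -/
theorem le_loc : ∀ (t : Fin 9) (s : Fin 4), 2 ≤ s.val → 9 ≤ (loc t s).val := by decide

/-- Typedness: XOR slots and AND slots never meet. -/
theorem loc_typed (t t' : Fin 9) (s s' : Fin 4) (hs : s.val < 2) (hs' : 2 ≤ s'.val) : loc t s ≠ loc t' s' := by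
  intro h
  have h1 := loc_lt t s hs
  have h2 := le_loc t' s' hs'
  rw [h] at h1
  omega

/-- Simple overlaps inside the gadget. -/
theorem vs_inter_card_le : ∀ t t' : Fin 9, t ≠ t' → (vs t ∩ vs t').card ≤ 1 := by decide

/-- Degree at most three inside the gadget. -/
theorem degree_le_three : ∀ l : Fin 15, (univ.filter fun t : Fin 9 => l ∈ vs t).card ≤ 3 := by decide

/-! ## Semantics of one copy -/

/-- The value of output `t` under a local assignment. -/
def evalL (z : Fin 15 → Bool) (t : Fin 9) : Bool := xor (xor (z (loc t 0)) (z (loc t 1))) (z (loc t 2) && z (loc t 3))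

/-- The targets: `y₀ = 1`, the other eight `0` (odd sum). -/
def y1 (t : Fin 9) : Bool := decide (t = 0)

/-- `P = p₀ ⊕ p₁ ⊕ p₂`. -/
def ploc (z : Fin 15 → Bool) : Bool := bpar (univ : Finset (Fin 3)) fun k => z (pv k)

/-- `Q = q₀ ⊕ q₁ ⊕ q₂`. -/
def qloc (z : Fin 15 → Bool) : Bool := bpar (univ : Finset (Fin 3)) fun k => z (qv k)

/-- Slot values, unfolded. -/
theorem evalL_eq (z : Fin 15 → Bool) (t : Fin 9) :
    evalL z t = xor (xor (z (xv t)) (z (xv (nx t)))) (z (pv (pI t)) && z (qv (qI t))) := rfl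

/-- Around the nine-cycle every `x` is read twice: the XOR parts cancel. -/
theorem cycle_cancel (x : Fin 9 → Bool) : bpar (univ : Finset (Fin 9)) (fun t => xor (x t) (x (nx t))) = false := by
  rw [bpar_xor]
  have h := bpar_map (Equiv.addRight (1 : Fin 9)).toEmbedding (univ : Finset (Fin 9)) x
  rw [Finset.map_univ_equiv] at h
  have h' : bpar (univ : Finset (Fin 9)) (fun t => x (nx t)) = bpar univ x := h.symm
  rw [h']
  cases bpar univ x <;> rfl

/-- The nine edges are all of `K_{3,3}`: `⊕_t p_{π t} q_{κ t} = P ∧ Q`. -/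
theorem k33_product : ∀ a b : Fin 3 → Bool,
    bpar (univ : Finset (Fin 9)) (fun t => a (pI t) && b (qI t)) = (bpar (univ : Finset (Fin 3)) a && bpar (univ : Finset (Fin 3)) b) := by
  decide

/-- The targets have odd sum. -/
theorem bpar_y1 : bpar (univ : Finset (Fin 9)) y1 = true := by decide

/-- **If all nine outputs hold then `P = 1` (and `Q = 1`).** -/
theorem ploc_of_all (z : Fin 15 → Bool) (h : ∀ t, evalL z t = y1 t) : ploc z = true := by
  have hsum : bpar (univ : Finset (Fin 9)) (evalL z) = true := by
    rw [bpar_congr (fun t _ => h t)]; exact bpar_y1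
  have hsplit : bpar (univ : Finset (Fin 9)) (evalL z) =
      xor (bpar (univ : Finset (Fin 9)) (fun t => xor (z (xv t)) (z (xv (nx t)))))
        (bpar (univ : Finset (Fin 9)) (fun t => z (pv (pI t)) && z (qv (qI t)))) := by
    rw [← bpar_xor]; rfl
  rw [hsplit, cycle_cancel (fun u => z (xv u)), k33_product (fun k => z (pv k)) (fun k => z (qv k)), Bool.false_xor] at hsum
  unfold ploc
  revert hsum
  cases bpar (univ : Finset (Fin 3)) (fun k => z (pv k)) <;> simp

/-! ## The two witnesses -/

/-- The FULL assignment: all AND variables `1`, `x = (0,0,1,0,1,0,1,0,1)`. -/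
def zfull (l : Fin 15) : Bool := if l.val < 9 then decide (2 ≤ l.val ∧ l.val % 2 = 0) else true

/-- The DELETED assignment for output `t₀`: all AND variables `0`, `x_u = [1 ≤ u ≤ t₀]`. -/
def zdel (t₀ : Fin 9) (l : Fin 15) : Bool := if l.val < 9 then decide (0 < l.val ∧ l.val ≤ t₀.val) else false

/-- `zfull` satisfies all nine outputs. -/
theorem evalL_zfull : ∀ t : Fin 9, evalL zfull t = y1 t := by decide

/-- `zfull` has `P = 1`. -/
theorem ploc_zfull : ploc zfull = true := by decide

/-- `zdel t₀` satisfies every output but `t₀`. -/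
theorem evalL_zdel : ∀ t₀ t : Fin 9, t ≠ t₀ → evalL (zdel t₀) t = y1 t := by decide

/-- `zdel t₀` has `P = 0`. -/
theorem ploc_zdel : ∀ t₀ : Fin 9, ploc (zdel t₀) = false := by decide

end Summit.PneNP.PneNP.Theorems.PstarGapGadget
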